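import Literature.AlgebraicGeometry.Motives.KunnethEndomorphismClasses
import HarnessLib

/-!
# Divisor classes on `E × E` and on the powers `Eᵍ` from the endomorphisms of `E`

The step "`NS(Eᵍ) ⊗ K → H²(Eᵍ)` is onto because `End E` is large" of the Tate / Lenstra–Zarhin
argument for powers of a (supersingular) elliptic curve (`Motives/SupersingularAbelianVariety`;
Tate 1966, Thm. 4 and its proof for `E × E`; Lenstra–Zarhin 1993, §1), in the axiomatic setting
of a Weil cohomology theory `W` (Kleiman 1968, §1.2) and **without any input on `End E`**: the
largeness is the explicit hypothesis that the pull-backs `f*`, `f : E → E` a `k`-morphism, span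
`End_K H¹(E)` over `K`.

* `WeilCohomology.externalCup_one_one_mem_algebraicClasses_of_span_eq_top`: for a smooth
  projective curve `X` whose endomorphisms `f*|H¹(X)` span `End_K H¹(X)`, every external
  product `pr₁* x ∪ pr₂* y` of degree-one classes is a `K`-combination of divisor classes on
  `X × X`. Proof: the class `u_f` of the transposed graph of `f` (axiom
  `exists_isInducedBy_pullback`) is `K(f*|H⁰) + K(f*|H¹) + K(f*|H²)`
  (`eq_endClass_add_of_isInducedBy_one`), the outer terms are pulled back from the factors, so
  the Künneth class `K(f*|H¹)` is algebraic; `K` is `K`-linear, so `K(G)` is algebraic for every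
  `G` in the span, i.e. for every `G`; and `pr₁* x ∪ pr₂* y = K(G)` for a rank-one `G`.
* `WeilCohomology.algebraicClasses_self_tensor_one_eq_top`: hence the divisor classes span
  `H²(X × X)`.
* `WeilCohomology.externalCup_powSucc_mem_algebraicClasses`,
  `WeilCohomology.algebraicClasses_powSucc_one_eq_top`: for a one-dimensional abelian variety
  `E` with the same spanning hypothesis, **the divisor classes span `H²(Eᵐ⁺¹)`** for all the
  powers `E.powSucc m` (induction over `Eᵐ⁺¹ = Eᵐ × E`: `H¹(Eᵐ × E) = pr₁* H¹ + pr₂* H¹`, and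
  the mixed external products are pulled back from `Eᵐ × E` and `E × E`).

With `lefschetzClasses_eq_top_of_algebraicClasses_one_eq_top` (`Motives/LefschetzClassesProducts`)
this gives all of `H²ʳ(Eᵐ⁺¹)` as Lefschetz classes; what remains of the named fact
`LenstraZarhin1993_supersingular_lefschetzClasses_eq_top` is the spanning hypothesis for a
supersingular `E` (Deuring: `rank End E = 4`, `End⁰ E` a quaternion algebra) and the transfer
along the isogeny `A ∼ Eᵍ`.

Everything is a theorem with a real proof; no definitions, no named facts.

## References

* [Tate1966Endomorphisms] J. Tate, *Endomorphisms of abelian varieties over finite fields*,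
  Invent. Math. 2 (1966), Thm. 4 and §3 (the case `E × E`).
* [LenstraZarhin1993] H. W. Lenstra, Jr., Yu. G. Zarhin, Advances in Number Theory (1993), §1,
  p. 179.
* [Kleiman1968] S. Kleiman, *Algebraic cycles and the Weil conjectures* (1968), §1.2–1.3.
-/

universe u v

open CategoryTheory AlgebraicGeometry MonoidalCategory CartesianMonoidalCategory Opposite
open scoped TensorProduct

noncomputable section

namespace Literature.AlgebraicGeometry.Motives

namespace WeilCohomology

variable {k : Type u} [Field k] {K : Type v} [Field K] [CharZero K] (W : WeilCohomology k K)

/-! ## Curves: the `(1,1)` classes on `X × X` from the endomorphisms of `X` -/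

section Curve

variable {X : SchemeOver k}

/-- On a smooth projective curve the divisor classes span `H²(X)` (the top degree,
`lefschetzClasses_top_eq_top`). [cite: Kleiman1968, §1.2 (C)] -/
theorem algebraicClasses_one_eq_top_of_curve (hX : IsSmoothProjective 1 X) :
    W.algebraicClasses X 1 = ⊤ :=
  eq_top_iff.2 ((W.lefschetzClasses_top_eq_top hX).ge.trans
    (W.lefschetzClasses_le_algebraicClasses hX 1))

/-- **The `(1,1)` Künneth classes on `X × X` are divisor classes when the endomorphisms of the
curve `X` span `End H¹(X)`.** For `X` smooth projective of dimension `1` such that the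
pull-backs `f*|H¹(X)`, `f : X ⟶ X`, span `End_K H¹(X)` over `K`, every external product
`pr₁* x ∪ pr₂* y` (`x, y ∈ H¹(X)`) lies in the `K`-span of the divisor classes of `X × X`
(Tate 1966, proof of Thm. 4 for `E × E`: the graphs of endomorphisms; here via the Künneth
decomposition `u_f = K(f*|H⁰) + K(f*|H¹) + K(f*|H²)` of the class of the transposed graph,
`eq_endClass_add_of_isInducedBy_one`, linearity of `G ↦ K(G)`, and rank-one operators).
[cite: Tate1966Endomorphisms, Thm. 4 (proof)] -/
theorem externalCup_one_one_mem_algebraicClasses_of_span_eq_top (hX : IsSmoothProjective 1 X)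
    (hspan : Submodule.span K (Set.range fun f : X ⟶ X ↦ W.pullback f 1) = ⊤)
    (x y : W.obj X 1) :
    W.externalCup X X (show 1 + 1 = 2 * 1 by rfl) x y ∈ W.algebraicClasses (X ⊗ X) 1 := by
  classical
  haveI := W.finite_obj hX 0
  haveI := W.finite_obj hX 1
  haveI := W.finite_obj hX 2
  have hX1 := W.algebraicClasses_one_eq_top_of_curve hX
  let b₀ := Module.finBasis K (W.obj X 0)
  let b₁ := Module.finBasis K (W.obj X 1)
  let b₂ := Module.finBasis K (W.obj X 2)
  have h11 : 1 + 1 = 2 * 1 := rfl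
  -- the Künneth class of an endomorphism of `H¹(X)`, linearly in the endomorphism
  let M : (W.obj X 1 →ₗ[K] W.obj X 1) →ₗ[K] W.obj (X ⊗ X) (2 * 1) :=
    { toFun := fun G ↦ ∑ s, W.externalCup X X h11 (W.ofDualRight hX h11 (b₁.coord s)) (G (b₁ s))
      map_add' := fun G G' ↦ by
        simp only [LinearMap.add_apply, map_add, Finset.sum_add_distrib]
      map_smul' := fun c G ↦ by
        simp only [LinearMap.smul_apply, map_smul, RingHom.id_apply, Finset.smul_sum] }
  have hM : ∀ G, M G = ∑ s, W.externalCup X X h11 (W.ofDualRight hX h11 (b₁.coord s)) (G (b₁ s)) :=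
    fun G ↦ rfl
  -- Step 1: `M (f*)` is algebraic for every endomorphism `f` of `X`
  have step1 : ∀ f : X ⟶ X, M (W.pullback f 1) ∈ W.algebraicClasses (X ⊗ X) 1 := by
    intro f
    obtain ⟨u, hu, hind⟩ := W.exists_isInducedBy_pullback hX hX f
    have hdec := W.eq_endClass_add_of_isInducedBy_one hX b₀ b₁ b₂ (W.pullback f 0)
      (W.pullback f 1) (W.pullback f 2) (hind 0 2 rfl) (hind 1 1 rfl) (hind 2 0 rfl)
    have hM0 : (∑ s, W.externalCup X X (show 2 + 0 = 2 * 1 by rfl)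
        (W.ofDualRight hX (show 0 + 2 = 2 * 1 by rfl) (b₀.coord s)) (W.pullback f 0 (b₀ s))) ∈
        W.algebraicClasses (X ⊗ X) 1 :=
      Submodule.sum_mem _ fun s _ ↦ W.externalCup_mem_algebraicClasses_of_deg_zero_right hX hX
        (p := 1) _ (by rw [hX1]; trivial) _
    have hM2 : (∑ s, W.externalCup X X (show 0 + 2 = 2 * 1 by rfl)
        (W.ofDualRight hX (show 2 + 0 = 2 * 1 by rfl) (b₂.coord s)) (W.pullback f 2 (b₂ s))) ∈
        W.algebraicClasses (X ⊗ X) 1 :=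
      Submodule.sum_mem _ fun s _ ↦ W.externalCup_mem_algebraicClasses_of_deg_zero_left hX hX
        (p := 1) _ _ (by rw [hX1]; trivial)
    have hualg : u ∈ W.algebraicClasses (X ⊗ X) 1 :=
      W.ratAlgebraicClasses_le_algebraicClasses _ 1 hu
    have hMf : M (W.pullback f 1) = u -
        (∑ s, W.externalCup X X (show 2 + 0 = 2 * 1 by rfl)
          (W.ofDualRight hX (show 0 + 2 = 2 * 1 by rfl) (b₀.coord s)) (W.pullback f 0 (b₀ s))) -
        (∑ s, W.externalCup X X (show 0 + 2 = 2 * 1 by rfl)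
          (W.ofDualRight hX (show 2 + 0 = 2 * 1 by rfl) (b₂.coord s)) (W.pullback f 2 (b₂ s))) := by
      rw [hdec, hM]
      abel
    rw [hMf]
    exact sub_mem (sub_mem hualg hM0) hM2
  -- Step 2: `M G` is algebraic for every `G` (the `f*` span `End H¹(X)`)
  have step2 : ∀ G, M G ∈ W.algebraicClasses (X ⊗ X) 1 := by
    intro G
    have hG : G ∈ Submodule.span K (Set.range fun f : X ⟶ X ↦ W.pullback f 1) := by
      rw [hspan]; trivial
    rw [← Submodule.mem_comap]
    refine (Submodule.span_le.mpr ?_) hG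
    rintro _ ⟨f, rfl⟩
    exact step1 f
  -- Step 3: `pr₁* x ∪ pr₂* y = M G` for a rank-one `G`
  let e := W.ofDualRight hX h11
  let c : Module.Basis (Fin (Module.finrank K (W.obj X 1))) K (W.obj X 1) := b₁.dualBasis.map e
  have hc : ∀ s, c s = e (b₁.coord s) := fun s ↦ by
    simp only [c, Module.Basis.map_apply, Module.Basis.coe_dualBasis]
  let φ : Module.Dual K (W.obj X 1) := ∑ s, c.repr x s • b₁.coord s
  let G : W.obj X 1 →ₗ[K] W.obj X 1 := φ.smulRight y
  have hGb : ∀ t, G (b₁ t) = c.repr x t • y := by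
    intro t
    simp only [G, φ, LinearMap.smulRight_apply, LinearMap.sum_apply, LinearMap.smul_apply,
      Module.Basis.coord_apply, Module.Basis.repr_self, smul_eq_mul]
    congr 1
    rw [Finset.sum_eq_single t]
    · rw [Finsupp.single_eq_same, mul_one]
    · intro s _ hst
      rw [Finsupp.single_apply, if_neg (Ne.symm hst), mul_zero]
    · intro ht
      exact absurd (Finset.mem_univ t) ht
  have hMG : M G = W.externalCup X X h11 x y := by
    rw [hM]
    simp only [hGb, map_smul]
    calc ∑ s, c.repr x s • W.externalCup X X h11 (W.ofDualRight hX h11 (b₁.coord s)) y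
        = W.externalCup X X h11 (∑ s, c.repr x s • c s) y := by
          rw [LinearMap.map_sum₂]
          refine Finset.sum_congr rfl fun s _ ↦ ?_
          rw [LinearMap.map_smul₂, hc]
      _ = W.externalCup X X h11 x y := by rw [c.sum_repr x]
  rw [← hMG]
  exact step2 G

/-- **The divisor classes span `H²(X × X)`** for a smooth projective curve `X` whose
endomorphisms span `End_K H¹(X)` (Künneth in degree two, `algebraicClasses_tensor_one_eq_top`,
with `externalCup_one_one_mem_algebraicClasses_of_span_eq_top`; Tate 1966, Thm. 4 for `E × E`
with `E` supersingular over a large finite field). [cite: Tate1966Endomorphisms, Thm. 4 (proof)] -/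
theorem algebraicClasses_self_tensor_one_eq_top (hX : IsSmoothProjective 1 X)
    (hspan : Submodule.span K (Set.range fun f : X ⟶ X ↦ W.pullback f 1) = ⊤) :
    W.algebraicClasses (X ⊗ X) 1 = ⊤ :=
  W.algebraicClasses_tensor_one_eq_top hX hX (W.algebraicClasses_one_eq_top_of_curve hX)
    (W.algebraicClasses_one_eq_top_of_curve hX)
    (W.externalCup_one_one_mem_algebraicClasses_of_span_eq_top hX hspan)

end Curve

/-! ## Powers of a one-dimensional abelian variety -/

section Powers

variable (E : AbelianVariety k)

/-- A one-dimensional abelian variety is a smooth projective curve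
(`AbelianVariety.isSmoothProjective_holds`).
[cite: MumfordAV1970, §4 (ii) and §6 Application 1 (p. 62)] -/
theorem
    _root_.Literature.AlgebraicGeometry.Motives.AbelianVariety.isSmoothProjective_one_of_dim_eq_one
    (hE : E.dim = 1) : IsSmoothProjective 1 E.X :=
  hE ▸ (AbelianVariety.isSmoothProjective_holds (A := E))

/-- **Mixed divisor classes on `Eᵐ⁺¹ × E`.** For a one-dimensional abelian variety `E` whose
endomorphisms span `End_K H¹(E)`, every external product `pr₁* w ∪ pr₂* e` with
`w ∈ H¹(Eᵐ⁺¹)`, `e ∈ H¹(E)` is a `K`-combination of divisor classes on `Eᵐ⁺¹ × E = Eᵐ⁺²`: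
`H¹(Eᵐ × E) = pr₁* H¹(Eᵐ) + pr₂* H¹(E)` (`exists_eq_pullback_add_pullback`) and the two kinds of
mixed products are pulled back from `Eᵐ × E` (induction) and from `E × E`
(`externalCup_one_one_mem_algebraicClasses_of_span_eq_top`).
[cite: Tate1966Endomorphisms, Thm. 4 (proof)] -/
theorem externalCup_powSucc_mem_algebraicClasses (hE : E.dim = 1)
    (hspan : Submodule.span K (Set.range fun f : E.X ⟶ E.X ↦ W.pullback f 1) = ⊤) :
    ∀ (m : ℕ) (w : W.obj (E.powSucc m).X 1) (e : W.obj E.X 1),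
      W.externalCup (E.powSucc m).X E.X (show 1 + 1 = 2 * 1 by rfl) w e ∈
        W.algebraicClasses ((E.powSucc m).X ⊗ E.X) 1 := by
  have hE1 := E.isSmoothProjective_one_of_dim_eq_one hE
  intro m
  induction m with
  | zero => exact W.externalCup_one_one_mem_algebraicClasses_of_span_eq_top hE1 hspan
  | succ m ih =>
    intro w e
    have hXm : IsSmoothProjective (E.powSucc m).dim (E.powSucc m).X :=
      AbelianVariety.isSmoothProjective_holds
    have hXm1 : IsSmoothProjective (E.powSucc (m + 1)).dim (E.powSucc (m + 1)).X :=
      AbelianVariety.isSmoothProjective_holds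
    have hXm2 : IsSmoothProjective (E.powSucc (m + 1 + 1)).dim (E.powSucc (m + 1 + 1)).X :=
      AbelianVariety.isSmoothProjective_holds
    -- `Eᵐ⁺² = Eᵐ⁺¹ × E`, definitionally
    change W.obj ((E.powSucc m).X ⊗ E.X) 1 at w
    change W.externalCup ((E.powSucc m).X ⊗ E.X) E.X _ w e ∈
      W.algebraicClasses (((E.powSucc m).X ⊗ E.X) ⊗ E.X) 1
    change IsSmoothProjective _ ((E.powSucc m).X ⊗ E.X) at hXm1
    change IsSmoothProjective _ (((E.powSucc m).X ⊗ E.X) ⊗ E.X) at hXm2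
    obtain ⟨w', e', rfl⟩ := W.exists_eq_pullback_add_pullback hXm hE1 w
    rw [LinearMap.map_add₂]
    refine add_mem ?_ ?_
    · -- pulled back from `Eᵐ⁺¹ × E` along `(pr₁ ≫ pr₁, pr₂)`
      let φ : ((E.powSucc m).X ⊗ E.X) ⊗ E.X ⟶ (E.powSucc m).X ⊗ E.X :=
        CartesianMonoidalCategory.lift (fst _ _ ≫ fst _ _) (snd _ _)
      have hφ : W.externalCup ((E.powSucc m).X ⊗ E.X) E.X (show 1 + 1 = 2 * 1 by rfl)
          (W.pullback (fst (E.powSucc m).X E.X) 1 w') e =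
          W.pullback φ (2 * 1)
            (W.externalCup (E.powSucc m).X E.X (show 1 + 1 = 2 * 1 by rfl) w' e) := by
        rw [W.pullback_externalCup hXm2 hXm1 φ, CartesianMonoidalCategory.lift_fst,
          CartesianMonoidalCategory.lift_snd, externalCup_apply, W.pullback_comp]
        rfl
      rw [hφ]
      exact W.map_algebraicClasses_le hXm2 hXm1 φ 1 ⟨_, ih w' e, rfl⟩
    · -- pulled back from `E × E` along `(pr₁ ≫ pr₂, pr₂)`
      let ψ : ((E.powSucc m).X ⊗ E.X) ⊗ E.X ⟶ E.X ⊗ E.X :=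
        CartesianMonoidalCategory.lift (fst _ _ ≫ snd _ _) (snd _ _)
      have hψ : W.externalCup ((E.powSucc m).X ⊗ E.X) E.X (show 1 + 1 = 2 * 1 by rfl)
          (W.pullback (snd (E.powSucc m).X E.X) 1 e') e =
          W.pullback ψ (2 * 1) (W.externalCup E.X E.X (show 1 + 1 = 2 * 1 by rfl) e' e) := by
        rw [W.pullback_externalCup hXm2 (isSmoothProjective_tensor hE1 hE1) ψ,
          CartesianMonoidalCategory.lift_fst, CartesianMonoidalCategory.lift_snd, externalCup_apply,
          W.pullback_comp]
        rfl
      rw [hψ]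
      exact W.map_algebraicClasses_le hXm2 (isSmoothProjective_tensor hE1 hE1) ψ 1
        ⟨_, W.externalCup_one_one_mem_algebraicClasses_of_span_eq_top hE1 hspan e' e, rfl⟩

/-- **The divisor classes span `H²(Eᵐ⁺¹)`** for every power of a one-dimensional abelian
variety `E` whose endomorphisms `f*|H¹(E)` span `End_K H¹(E)` (induction over
`Eᵐ⁺² = Eᵐ⁺¹ × E` with `algebraicClasses_tensor_one_eq_top`; Tate 1966, Thm. 4; the input
"`NS(Eᵍ) ⊗ K = H²(Eᵍ)`" of Lenstra–Zarhin 1993, §1, for supersingular `E`).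
[cite: Tate1966Endomorphisms, Thm. 4 (proof)] -/
theorem algebraicClasses_powSucc_one_eq_top (hE : E.dim = 1)
    (hspan : Submodule.span K (Set.range fun f : E.X ⟶ E.X ↦ W.pullback f 1) = ⊤) (m : ℕ) :
    W.algebraicClasses (E.powSucc m).X 1 = ⊤ := by
  have hE1 := E.isSmoothProjective_one_of_dim_eq_one hE
  induction m with
  | zero => exact W.algebraicClasses_one_eq_top_of_curve hE1
  | succ m ih =>
    have hXm : IsSmoothProjective (E.powSucc m).dim (E.powSucc m).X :=
      AbelianVariety.isSmoothProjective_holds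
    exact W.algebraicClasses_tensor_one_eq_top hXm hE1 ih
      (W.algebraicClasses_one_eq_top_of_curve hE1)
      (W.externalCup_powSucc_mem_algebraicClasses E hE hspan m)

end Powers

end WeilCohomology

end Literature.AlgebraicGeometry.Motives

end
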